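import Literature.AlgebraicGeometry.Modules.CechOrderedResolution
import Literature.AlgebraicGeometry.Modules.CechSheafAcyclic
import Literature.AlgebraicGeometry.Modules.CechComputesCohomology
import Literature.Algebra.Homology.ExtOfAcyclicResolutionNaturality
import HarnessLib

/-!
# The ordered Čech complex of an affine cover computes `Ext(𝒪_X, M)` for quasi-coherent `M`, naturally
# in `M` (Görtz–Wedhorn II, Thm. 22.9; Hartshorne III Thm. 4.5; The Stacks Project, Tags 01XD, 01FM)

Let `X` be a scheme, `𝓤 = (U_i)_{i ∈ ι}` a finite linearly ordered open cover all of whose finite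
intersections `U_s = ⋂_{i ∈ s} U_i` (`s ≠ ∅`) are AFFINE, and `M` an affine-localizing (e.g.
quasi-coherent) `𝒪_X`-module. Then the ORDERED Čech complex of global sections
`Γ(X, Č•_ord(𝓤, M)) = Π_{#s = n+1} Γ(U_s, M)` computes `Ext(𝒪_X, M)`:

* `CechOrd.isAffineOpen_face_faces`, `CechOrd.isBasis_faces` — the faces of the family of `n`-faces
  are the `U_s`, and the basic opens of the `U_i` meet them in affine opens;
* `CechOrd.subsingleton_ext_unit_obj` — `Ext^{q+1}(𝒪_X, Čⁿ_ord(𝓤, M)) = 0`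
  (`Modules/CechSheafAcyclic`, basis variant);
* `CechOrd.homComplex U M = Hom(𝒪_X, Č•_ord(𝓤, M))`, **`CechOrd.extUnitAddEquivHomologySucc`**:
  **`Extⁿ⁺¹(𝒪_X, M) ≃+ Hⁿ⁺¹(Γ(X, Č•_ord(𝓤, M)))`**, `CechOrd.extUnitAddEquivHomologyZero`
  (Görtz–Wedhorn II Thm. 22.9: "Let `X` be a separated scheme … `𝓤` an affine open covering …
  `Hⁿ(X, 𝓕) = Ȟⁿ(𝓤, 𝓕)` … computed by the alternating/ordered Čech complex");
* functoriality in `M`: `CechOrd.map`, `CechOrd.mapComplex`, and the **naturality**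
  `CechOrd.extUnitAddEquivHomologySucc_naturality`: the isomorphism intertwines `φ_*` on `Ext` with
  `H(φ_*)` on Čech cohomology (`Algebra/Homology/ExtOfAcyclicResolutionNaturality`) — in particular
  it is linear for the action of global functions (`φ = a • 𝟙_M`);
* the cochain dictionary `CechOrd.homTopAddEquiv : Ext⁰(𝒪_X, Čⁿ_ord) ≃+ Π_s Γ(M, X ∩ U_s)` and its
  compatibility with the differentials (`homTopAddEquiv_d`).

Everything is proved; no named facts.

## References

* U. Görtz, T. Wedhorn, *Algebraic Geometry II: Cohomology of Schemes* (2023), Def. 21.68,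
  Prop. 21.69, Thm. 22.9 (p. 332). [GortzWedhorn2023]
* R. Hartshorne, *Algebraic Geometry*, GTM 52 (1977), III Thm. 4.5. [Hartshorne1977]
* The Stacks Project, Tags 01XD, 01FM. [StacksProject]
-/

noncomputable section

universe w u

open CategoryTheory CategoryTheory.Abelian CategoryTheory.Limits Opposite TopologicalSpace
  AlgebraicGeometry
open Literature.AlgebraicGeometry.HodgeTheory Literature.AlgebraicGeometry.Motives
open Literature.Algebra.Homology

namespace Literature.AlgebraicGeometry.Modules

namespace CechOrd

variable {X : Scheme.{u}} {ι : Type u} [LinearOrder ι] [Fintype ι] (U : ι → X.Opens) (M : X.Modules)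

/-! ### The faces of the family of `n`-faces; the basis of basic opens -/

omit [Fintype ι] in
/-- A face of the family of `n`-faces is `U_s` for the union `s` of the simplices involved.
[cite: GortzWedhorn2023, Def. 21.64 (p. 258)] -/
lemma face_faces_eq {n m : ℕ} (β : Fin (m + 1) → Simplex ι n) :
    face (faces U n) β = faceSet U (Finset.univ.biUnion fun k => (β k).1) := by
  unfold face faceSet faces
  rw [Finset.iInf_biUnion]
  apply le_antisymm
  · exact le_iInf₂ fun k _ => iInf_le _ k
  · exact le_iInf fun k => iInf₂_le k (Finset.mem_univ k)

omit [Fintype ι] in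
/-- If all `U_s` (`s ≠ ∅`) are affine, the faces of the family of `n`-faces are affine.
[cite: GortzWedhorn2023, Thm. 22.9 (p. 332)] -/
lemma isAffineOpen_face_faces (hU : ∀ s : Finset ι, s.Nonempty → IsAffineOpen (faceSet U s))
    {n m : ℕ} (β : Fin (m + 1) → Simplex ι n) : IsAffineOpen (face (faces U n) β) := by
  rw [face_faces_eq]
  refine hU _ ?_
  obtain ⟨i, hi⟩ : (β 0).1.Nonempty := Finset.card_pos.mp (by rw [(β 0).2]; exact Nat.succ_pos n)
  exact ⟨i, Finset.mem_biUnion.mpr ⟨0, Finset.mem_univ _, hi⟩⟩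

omit [Fintype ι] in
/-- **The basic opens of the members of an affine-intersection cover meet every `U_s` in an affine
open**: `D(f) ∩ U_s = D(f|_{U_i ∩ U_s})`, `f ∈ Γ(U_i, 𝒪_X)`, and `U_i ∩ U_s = U_{s ∪ i}` is affine;
these opens form a basis. [cite: StacksProject, Tag 01XD (proof)] -/
lemma isBasis_faces (hU : ∀ s : Finset ι, s.Nonempty → IsAffineOpen (faceSet U s))
    (hcov : ⨆ i, U i = ⊤) (n : ℕ) :
    Opens.IsBasis {W : X.Opens | ∀ (m : ℕ) (β : Fin (m + 1) → Simplex ι n),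
      IsAffineOpen (W ⊓ face (faces U n) β)} := by
  rw [Opens.isBasis_iff_nbhd]
  intro V x hx
  obtain ⟨i, hi⟩ := Cech.exists_mem U hcov x
  have hUi : IsAffineOpen (U i) := by
    have h := hU {i} (Finset.singleton_nonempty i)
    have e : faceSet U {i} = U i := by
      unfold faceSet; exact le_antisymm (iInf₂_le i (Finset.mem_singleton_self i))
        (le_iInf₂ fun j hj => by rw [Finset.mem_singleton.mp hj])
    rwa [e] at h
  obtain ⟨f, hfV, hxf⟩ := hUi.exists_basicOpen_le ⟨x, hx⟩ hi
  refine ⟨X.basicOpen f, fun m β => ?_, hxf, hfV⟩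
  rw [face_faces_eq]
  set s := Finset.univ.biUnion fun k => (β k).1
  have hle : U i ⊓ faceSet U s ≤ U i := inf_le_left
  have e : X.basicOpen f ⊓ faceSet U s = X.basicOpen (X.presheaf.map (homOfLE hle).op f) := by
    rw [Scheme.basicOpen_res, inf_assoc, inf_comm (faceSet U s) (X.basicOpen f), ← inf_assoc,
      inf_eq_right.mpr (X.basicOpen_le f)]
  rw [e]
  refine IsAffineOpen.basicOpen ?_ _
  rw [← faceSet_insert]
  exact hU _ (Finset.insert_nonempty i s)

/-! ### Acyclicity of the ordered Čech sheaves -/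

omit [Fintype ι] in
/-- **`Ext^{q+1}_{𝒪_X}(𝒪_X, Čⁿ_ord(𝓤, M)) = 0`** for `M` affine-localizing and a cover `𝓤` with affine
finite intersections (`Modules/CechSheafAcyclic`, basis variant, for the family of `n`-faces).
[cite: Hartshorne1977, III Thm. 4.5 (proof)] [cite: StacksProject, Tag 01XD] -/
theorem subsingleton_ext_unit_obj [HasExt.{w} X.Modules]
    (hU : ∀ s : Finset ι, s.Nonempty → IsAffineOpen (faceSet U s)) (hcov : ⨆ i, U i = ⊤)
    (hM : IsAffineLocalizing M) (n q : ℕ) :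
    Subsingleton (Ext.{w} (unitModule X) (obj U M n) (q + 1)) :=
  Cech.subsingleton_ext_unit_obj_of_isAffineLocalizing_of_isBasis (faces U n) 0
    (fun β => isAffineOpen_face_faces U hU β) (isBasis_faces U hU hcov n) hM q

/-- `Ext^{q+1}(𝒪_X, –)` vanishes on the terms of `CechOrd.complex U M` (restatement of
`subsingleton_ext_unit_obj` on the syntactic terms of the complex). [cite: Hartshorne1977, III Thm. 4.5 (proof)] -/
theorem subsingleton_ext_unit_complex_X [HasExt.{w} X.Modules]
    (hU : ∀ s : Finset ι, s.Nonempty → IsAffineOpen (faceSet U s)) (hcov : ⨆ i, U i = ⊤)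
    (hM : IsAffineLocalizing M) (n q : ℕ) :
    Subsingleton (Ext.{w} (unitModule X) ((complex U M).X n) (q + 1)) := by
  rw [complex_X]
  exact subsingleton_ext_unit_obj U M hU hcov hM n q

/-! ### Functoriality in `M` -/

variable {M} {N : X.Modules} (φ : M ⟶ N)

/-- `Čⁿ_ord(𝓤, φ)`, componentwise. [cite: GortzWedhorn2023, Def. 21.68 (p. 260)] -/
abbrev map (n : ℕ) : obj U M n ⟶ obj U N n := Cech.map (faces U n) 0 M φ

omit [Fintype ι] in
/-- The face maps commute with `Čⁿ_ord(𝓤, φ)`. [cite: GortzWedhorn2023, Def. 21.68 (p. 260)] -/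
lemma faceMap_map (n : ℕ) (a : ι) : faceMap U M n a ≫ map U φ (n + 1) = map U φ n ≫ faceMap U N n a :=
  Cech.hom_ext_to fun V c β => by
    rw [Scheme.Modules.Hom.comp_app, Scheme.Modules.Hom.comp_app, CategoryTheory.comp_apply,
      CategoryTheory.comp_apply, Cech.map_app_apply, faceMap_app, faceMap_app]
    by_cases h : a ∈ (β 0).1
    · rw [faceFun_apply_of_mem _ _ _ _ _ _ _ h, faceFun_apply_of_mem _ _ _ _ _ _ _ h, map_zsmul,
        Cech.app_res, Cech.map_app_apply]
    · rw [faceFun_apply_of_not_mem _ _ _ _ _ _ _ h, faceFun_apply_of_not_mem _ _ _ _ _ _ _ h, map_zero]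

/-- The differential commutes with `Čⁿ_ord(𝓤, φ)`. [cite: GortzWedhorn2023, Def. 21.68 (p. 260)] -/
lemma d_map (n : ℕ) : d U M n ≫ map U φ (n + 1) = map U φ n ≫ d U N n := by
  rw [d, d, Preadditive.sum_comp, Preadditive.comp_sum]
  exact Finset.sum_congr rfl fun a _ => faceMap_map U φ n a

/-- **`Č•_ord(𝓤, φ) : Č•_ord(𝓤, M) → Č•_ord(𝓤, N)`** as a cochain map. [cite: GortzWedhorn2023, Def. 21.68 (p. 260)] -/
def mapComplex : complex U M ⟶ complex U N :=
  CochainComplex.ofHom (fun n => map U φ n) fun n => by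
    rw [complex_d, complex_d]; exact (d_map U φ n).symm

/-- Components of `mapComplex`. [cite: GortzWedhorn2023, Def. 21.68 (p. 260)] -/
@[simp] lemma mapComplex_f (n : ℕ) : (mapComplex U φ).f n = map U φ n := rfl

omit [Fintype ι] in
/-- The augmentation is natural: `ε_M ≫ Č⁰(φ) = φ ≫ ε_N`. [cite: Hartshorne1977, III Lemma 4.2] -/
lemma augment_map : augment U M ≫ map U φ 0 = φ ≫ augment U N :=
  Cech.hom_ext_to fun V x β => by
    rw [Scheme.Modules.Hom.comp_app, Scheme.Modules.Hom.comp_app, CategoryTheory.comp_apply,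
      CategoryTheory.comp_apply, Cech.map_app_apply, Cech.augment_app_apply, Cech.augment_app_apply,
      Cech.app_res]

variable (M)

/-! ### Leray's theorem for the ordered complex -/

variable [HasExt.{w} X.Modules]

/-- **The ordered Čech complex of global sections** `Γ(X, Č•_ord(𝓤, M)) = Hom(𝒪_X, Č•_ord(𝓤, M))`
(as the complex `Ext⁰(𝒪_X, Č•_ord(𝓤, M))` of abelian groups). [cite: GortzWedhorn2023, Def. 21.68 (p. 260)] -/
abbrev homComplex : CochainComplex AddCommGrpCat.{w} ℕ :=
  AcyclicResolution.extComplex (unitModule X) (complex U M)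

/-- **`Ext⁰(𝒪_X, M) ≃+ H⁰(Γ(X, Č•_ord(𝓤, M)))`** for a finite cover. [cite: GortzWedhorn2023, Thm. 22.9 (p. 332)] -/
def extUnitAddEquivHomologyZero (hcov : ⨆ i, U i = ⊤) :
    Ext.{w} (unitModule X) M 0 ≃+ ((homComplex U M).homology 0 : AddCommGrpCat.{w}) :=
  haveI := (exactAugmentation U M hcov).mono_ε
  AcyclicResolution.extAddEquivHomologyZero (unitModule X) (complex U M) (exactAugmentation U M hcov).ε
    (exactAugmentation U M hcov).ε_d (exactAugmentation U M hcov).exact₀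

/-- **Leray for the ordered complex: `Extⁿ⁺¹_{𝒪_X}(𝒪_X, M) ≃+ Hⁿ⁺¹(Γ(X, Č•_ord(𝓤, M)))`** for `M`
affine-localizing (e.g. quasi-coherent) and a finite cover `𝓤` with affine finite intersections.
[cite: GortzWedhorn2023, Thm. 22.9 (p. 332)] [cite: Hartshorne1977, III Thm. 4.5] [cite: StacksProject, Tag 01XD] -/
def extUnitAddEquivHomologySucc (hU : ∀ s : Finset ι, s.Nonempty → IsAffineOpen (faceSet U s))
    (hcov : ⨆ i, U i = ⊤) (hM : IsAffineLocalizing M) (n : ℕ) :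
    Ext.{w} (unitModule X) M (n + 1) ≃+ ((homComplex U M).homology (n + 1) : AddCommGrpCat.{w}) :=
  haveI := (exactAugmentation U M hcov).mono_ε
  AcyclicResolution.extAddEquivHomologySucc (unitModule X) (complex U M) (exactAugmentation U M hcov).ε
    (exactAugmentation U M hcov).ε_d (exactAugmentation U M hcov).exact₀
    (exactAugmentation U M hcov).exactAt_succ
    (fun k q e => (subsingleton_ext_unit_complex_X U M hU hcov hM k q).elim e 0) n

variable {M}

/-- **Naturality in `M`** of `extUnitAddEquivHomologySucc`: for `φ : M → N` (both affine-localizing),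
`Hⁿ⁺¹(Č•_ord(𝓤, φ)) ∘ Φ_M = Φ_N ∘ (– ∘ [φ])`. In particular (`φ = a • 𝟙_M`, `a ∈ Γ(X, 𝒪_X)`) the
isomorphism is linear for the action of global functions. [cite: GortzWedhorn2023, Thm. 22.9 (p. 332)] -/
theorem extUnitAddEquivHomologySucc_naturality
    (hU : ∀ s : Finset ι, s.Nonempty → IsAffineOpen (faceSet U s)) (hcov : ⨆ i, U i = ⊤)
    (hM : IsAffineLocalizing M) (hN : IsAffineLocalizing N) (n : ℕ) (x : Ext.{w} (unitModule X) M (n + 1)) :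
    (HomologicalComplex.homologyMap (AcyclicResolution.extComplexMap (unitModule X) (mapComplex U φ))
        (n + 1)).hom (extUnitAddEquivHomologySucc U M hU hcov hM n x) =
      extUnitAddEquivHomologySucc U N hU hcov hN n (x.comp (Ext.mk₀ φ) (add_zero _)) := by
  haveI := (exactAugmentation U M hcov).mono_ε
  haveI := (exactAugmentation U N hcov).mono_ε
  exact AcyclicResolution.extAddEquivHomologySucc_naturality (unitModule X) (mapComplex U φ)
    (exactAugmentation U M hcov).ε (exactAugmentation U M hcov).ε_d (exactAugmentation U M hcov).exact₀
    (exactAugmentation U N hcov).ε (exactAugmentation U N hcov).ε_d (exactAugmentation U N hcov).exact₀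
    φ (augment_map U φ) (exactAugmentation U M hcov).exactAt_succ
    (fun k q e => (subsingleton_ext_unit_complex_X U M hU hcov hM k q).elim e 0)
    (exactAugmentation U N hcov).exactAt_succ
    (fun k q e => (subsingleton_ext_unit_complex_X U N hU hcov hN k q).elim e 0) n x

variable (M)

/-! ### The cochain dictionary -/

/-- **The cochains of `Hom(𝒪_X, Č•_ord(𝓤, M))` are the ordered Čech cochains `Π_s Γ(M, X ∩ U_s)`.**
[cite: GortzWedhorn2023, Def. 21.68 (p. 260)] -/
def homTopAddEquiv (n : ℕ) :
    Ext.{w} (unitModule X) ((complex U M).X n) 0 ≃+ Cech.Sections (faces U n) 0 M ⊤ :=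
  Ext.addEquiv₀.trans (Cech.homTopAddEquivSections ((complex U M).X n))

/-- `homTopAddEquiv [f] = f_X(1)`. [cite: GortzWedhorn2023, Def. 21.68 (p. 260)] -/
theorem homTopAddEquiv_mk₀ (n : ℕ) (f : unitModule X ⟶ (complex U M).X n) :
    homTopAddEquiv U M n (Ext.mk₀ f) =
      (f.app ⊤ (1 : X.presheaf.obj (op ⊤)) : Cech.Sections (faces U n) 0 M ⊤) := by
  change Cech.homTopAddEquivSections _ (Ext.addEquiv₀ (Ext.mk₀ f)) = _
  have h : Ext.addEquiv₀ (Ext.mk₀ f) = f := by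
    change Ext.homEquiv₀ (Ext.mk₀ f) = f
    rw [← Ext.homEquiv₀_symm_apply, Equiv.apply_symm_apply]
  rw [h]
  rfl

/-- **`homTopAddEquiv` intertwines the differential of `Hom(𝒪_X, Č•_ord(𝓤, M))` with the ordered Čech
differential `(d c)_t = Σ_{a ∈ t} ε(t, a) c_{t ∖ a}|` on cochains.** [cite: GortzWedhorn2023, Def. 21.68 (p. 260)] -/
theorem homTopAddEquiv_d (n : ℕ) (x : Ext.{w} (unitModule X) ((complex U M).X n) 0) :
    homTopAddEquiv U M (n + 1) (((homComplex U M).d n (n + 1)).hom x) =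
      ((d U M n).app ⊤ (homTopAddEquiv U M n x) : Cech.Sections (faces U (n + 1)) 0 M ⊤) := by
  obtain ⟨f, rfl⟩ : ∃ f : unitModule X ⟶ (complex U M).X n, Ext.mk₀ f = x :=
    ⟨Ext.homEquiv₀ x, Ext.mk₀_homEquiv₀_apply x⟩
  rw [AcyclicResolution.extComplex_d_apply, Ext.mk₀_comp_mk₀, homTopAddEquiv_mk₀, homTopAddEquiv_mk₀,
    complex_d, Scheme.Modules.Hom.comp_app, CategoryTheory.comp_apply]
  rfl

/-- The components of `Čⁿ_ord(𝓤, φ)` on the cochain side: `φ` componentwise. [cite: GortzWedhorn2023, Def. 21.68 (p. 260)] -/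
theorem homTopAddEquiv_map {N : X.Modules} (φ : M ⟶ N) (n : ℕ)
    (x : Ext.{w} (unitModule X) ((complex U M).X n) 0) (β : Idx ι n) :
    homTopAddEquiv U N n (((AcyclicResolution.extComplexMap (unitModule X) (mapComplex U φ)).f n).hom x) β =
      φ.app _ (homTopAddEquiv U M n x β) := by
  obtain ⟨f, rfl⟩ : ∃ f : unitModule X ⟶ (complex U M).X n, Ext.mk₀ f = x :=
    ⟨Ext.homEquiv₀ x, Ext.mk₀_homEquiv₀_apply x⟩
  rw [AcyclicResolution.extComplexMap_f_apply, Ext.mk₀_comp_mk₀, homTopAddEquiv_mk₀, homTopAddEquiv_mk₀,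
    mapComplex_f, Scheme.Modules.Hom.comp_app, CategoryTheory.comp_apply]
  rfl

end CechOrd

end Literature.AlgebraicGeometry.Modules

end
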